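import Summits.Parity.GeneralizedHardyLittlewood.Theorems.BeyondDiagonalBeatsQuarter.OffDiagPrincipalShortBound
import Mathlib.MeasureTheory.Integral.IntervalIntegral.FundThmCalculus
import HarnessLib

/-!
# Route `PrimeLevelFamEdge`, crux K_B (stmt-Parity-20343), line `diagonal_kernel_split` rev 4, plan Ω,
# OMEGA-BLUEPRINT v4 §3c — **the `k`-family large sieve with SAMPLE-DEPENDENT weights: the Gallagher–Sobolev device**
# (input I3 of the a8P-closable total, worker-3 sizing S 17:27Z)

The `k`-family half of the a8P-short bound (`OffDiagPrincipalShortBound` §4, `…ClosedForm`, prover-9's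
`largeSieve_family_mod_nat`) needs coefficients that do NOT depend on the sample `k`; but the sample sums of the
principal block term carry the box transform `𝓕(t₁ ↦ Φ_{p,q}(t₁, y))(ξ)` at the height `y = y_k = (n₀/e)·k`, a smooth
function of `y` on the box `[y₀, y₁]`. Instead of a finite-rank separation (`…_of_separated`) we use the
Gallagher–Sobolev device: `g(y_k) = g(y₀) + ∫_{y₀}^{y_k} g′`, so that

  `Σ_{k∈𝒦} ‖Σ_p c p·g_p(y_k)·E_p(k)‖ ≤ Σ_k ‖Σ_p c p·g_p(y₀)·E_p(k)‖ + ∫_{y₀}^{y₁} Σ_k ‖Σ_p c p·g′_p(t)·E_p(k)‖ dt`,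

two `k`-FREE families, each bounded by the family inequality. Abstractly (§1, `sum_norm_family_weight_le_of_hasDerivAt`):
if every `k`-free coefficient vector `b` obeys `Σ_{k∈𝒦} ‖Σ_p b p·E_p(k)‖ ≤ Λ·‖b‖₂`, then for `C¹` weights with
`‖g_p(y₀)‖ ≤ B₀`, `‖g′_p‖ ≤ B₁` on `[y₀,y₁]` and samples `y_k ∈ [y₀,y₁]`:
`Σ_{k∈𝒦} ‖Σ_p c p·g_p(y_k)·E_p(k)‖ ≤ Λ·(B₀ + (y₁ − y₀)·B₁)·‖c‖₂`.
§2 (`sum_norm_productPhase_weight_le_of_hasDerivAt`) instantiates `E_p(k) = e(σ·ν_p·k/D)` with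
`Λ = √#𝒦·√(m·(Y + 1 + 2D)·d)` from `sum_norm_productPhase_le_sqrt` (multiplicity `m` of `𝒦` mod `D`, fibre multiplicity
`d` of the product variable `ν p ∈ [1,Y]`). For the box transform `(y₁ − y₀)·B₁ ≍ B₀` (smooth on the scale of the box),
so the device costs a constant factor, not the large-sieve saving. The constants `B₀, B₁` are input I1 (u/y-regularity
of the box transform) — not here. Theorems only; standard axioms. Helper toward `stub_offDiagBelowSlack_io`; closes nothing.
«The programme SEARCHES and TYPES; no claim about Landau–Siegel zeros, Theorems 1–2 of arXiv:2211.02515 or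
a repaired Margin232 until a kernel theorem says so.»
-/

noncomputable section

open Real MeasureTheory Filter Complex Finset intervalIntegral
open scoped FourierTransform Topology Interval

namespace Summit.Parity.GeneralizedHardyLittlewood.Theorems.BeyondDiagonalBeatsQuarter.OffDiag

open Literature.NumberTheory.Sieve.LargeSieve (e)

/-! ### §1. The abstract device -/

/-- Weighted `ℓ²` norm against a uniform bound: `√(Σ_p ‖c p·w p‖²) ≤ B·√(Σ_p ‖c p‖²)` if `‖w p‖ ≤ B`, `B ≥ 0`.
[folklore] -/
theorem sqrt_sum_norm_sq_mul_le {ι : Type*} (P : Finset ι) (c w : ι → ℂ) {B : ℝ} (hB : 0 ≤ B)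
    (hw : ∀ p ∈ P, ‖w p‖ ≤ B) :
    Real.sqrt (∑ p ∈ P, ‖c p * w p‖ ^ 2) ≤ B * Real.sqrt (∑ p ∈ P, ‖c p‖ ^ 2) := by
  have h1 : ∑ p ∈ P, ‖c p * w p‖ ^ 2 ≤ B ^ 2 * ∑ p ∈ P, ‖c p‖ ^ 2 := by
    rw [Finset.mul_sum]
    refine Finset.sum_le_sum fun p hp ↦ ?_
    rw [norm_mul, mul_pow, mul_comm]
    exact mul_le_mul_of_nonneg_right (pow_le_pow_left₀ (norm_nonneg _) (hw p hp) 2) (sq_nonneg _)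
  calc Real.sqrt (∑ p ∈ P, ‖c p * w p‖ ^ 2) ≤ Real.sqrt (B ^ 2 * ∑ p ∈ P, ‖c p‖ ^ 2) := Real.sqrt_le_sqrt h1
    _ = B * Real.sqrt (∑ p ∈ P, ‖c p‖ ^ 2) := by rw [Real.sqrt_mul (sq_nonneg _), Real.sqrt_sq hB]

/-- **Gallagher–Sobolev device for a family inequality (abstract).** Let `E p k` be any family kernel for which every
`k`-free coefficient vector `b` obeys `Σ_{k∈𝒦} ‖Σ_{p∈P} b p·E p k‖ ≤ Λ·√(Σ_p ‖b p‖²)` (`Λ ≥ 0`). Let `g p` be `C¹` on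
`[y₀, y₁]` with derivative `g′ p` continuous there, `‖g p y₀‖ ≤ B₀`, `‖g′ p t‖ ≤ B₁` (`B₀, B₁ ≥ 0`), and let the samples
`y k ∈ [y₀, y₁]` (`k ∈ 𝒦`). Then
`Σ_{k∈𝒦} ‖Σ_p c p·g p (y k)·E p k‖ ≤ Λ·(B₀ + (y₁ − y₀)·B₁)·√(Σ_p ‖c p‖²)`.
[cite: Montgomery1971, Lemma 1.1 — derivation (Gallagher's Sobolev inequality `|f(x)| ≤ |f(y₀)| + ∫|f′|` under a family sum)] -/
theorem sum_norm_family_weight_le_of_hasDerivAt {ι : Type*} (P : Finset ι) (𝒦 : Finset ℤ) (E : ι → ℤ → ℂ)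
    {Λ : ℝ} (hΛ0 : 0 ≤ Λ)
    (hΛ : ∀ b : ι → ℂ, ∑ k ∈ 𝒦, ‖∑ p ∈ P, b p * E p k‖ ≤ Λ * Real.sqrt (∑ p ∈ P, ‖b p‖ ^ 2))
    (c : ι → ℂ) (g g' : ι → ℝ → ℂ) {y₀ y₁ : ℝ} (hy : y₀ ≤ y₁)
    (hg : ∀ p ∈ P, ∀ t ∈ Set.Icc y₀ y₁, HasDerivAt (g p) (g' p t) t)
    (hg' : ∀ p ∈ P, ContinuousOn (g' p) (Set.Icc y₀ y₁))
    {B₀ B₁ : ℝ} (hB₀0 : 0 ≤ B₀) (hB₁0 : 0 ≤ B₁) (hB₀ : ∀ p ∈ P, ‖g p y₀‖ ≤ B₀)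
    (hB₁ : ∀ p ∈ P, ∀ t ∈ Set.Icc y₀ y₁, ‖g' p t‖ ≤ B₁)
    (y : ℤ → ℝ) (hyk : ∀ k ∈ 𝒦, y k ∈ Set.Icc y₀ y₁) :
    ∑ k ∈ 𝒦, ‖∑ p ∈ P, c p * g p (y k) * E p k‖ ≤
      Λ * (B₀ + (y₁ - y₀) * B₁) * Real.sqrt (∑ p ∈ P, ‖c p‖ ^ 2) := by
  set C : ℝ := Real.sqrt (∑ p ∈ P, ‖c p‖ ^ 2) with hC
  -- continuity / integrability of the derivative families
  have hIcc : Set.uIcc y₀ y₁ = Set.Icc y₀ y₁ := Set.uIcc_of_le hy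
  have hcontN : ∀ k, ContinuousOn (fun t ↦ ‖∑ p ∈ P, c p * g' p t * E p k‖) (Set.Icc y₀ y₁) := by
    intro k
    refine ContinuousOn.norm (continuousOn_finsetSum _ fun p hp ↦ ?_)
    exact (continuousOn_const.mul (hg' p hp)).mul continuousOn_const
  have hintN : ∀ k, IntervalIntegrable (fun t ↦ ‖∑ p ∈ P, c p * g' p t * E p k‖) volume y₀ y₁ := by
    intro k
    refine ContinuousOn.intervalIntegrable ?_
    rw [hIcc]
    exact hcontN k
  -- per sample: value at `y₀` plus the integral of the derivative family
  have hk : ∀ k ∈ 𝒦, ‖∑ p ∈ P, c p * g p (y k) * E p k‖ ≤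
      ‖∑ p ∈ P, c p * g p y₀ * E p k‖ + ∫ t in y₀..y₁, ‖∑ p ∈ P, c p * g' p t * E p k‖ := by
    intro k hk
    obtain ⟨hk0, hk1⟩ := hyk k hk
    have hsub : Set.Icc y₀ (y k) ⊆ Set.Icc y₀ y₁ := Set.Icc_subset_Icc_right hk1
    have hIcck : Set.uIcc y₀ (y k) = Set.Icc y₀ (y k) := Set.uIcc_of_le hk0
    have hFTC : ∀ p ∈ P, g p (y k) = g p y₀ + ∫ t in y₀..y k, g' p t := by
      intro p hp
      have h := intervalIntegral.integral_eq_sub_of_hasDerivAt (f := g p) (f' := g' p) (a := y₀) (b := y k)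
        (fun t ht ↦ hg p hp t (hsub (hIcck ▸ ht))) ?_
      · rw [h]; ring
      · refine ContinuousOn.intervalIntegrable ?_
        rw [hIcck]
        exact (hg' p hp).mono hsub
    have hint_k : ∀ p ∈ P, IntervalIntegrable (fun t ↦ c p * g' p t * E p k) volume y₀ (y k) := by
      intro p hp
      refine ContinuousOn.intervalIntegrable ?_
      rw [hIcck]
      exact (continuousOn_const.mul ((hg' p hp).mono hsub)).mul continuousOn_const
    have hrep : ∑ p ∈ P, c p * g p (y k) * E p k =
        ∑ p ∈ P, c p * g p y₀ * E p k + ∫ t in y₀..y k, ∑ p ∈ P, c p * g' p t * E p k := by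
      rw [intervalIntegral.integral_finsetSum hint_k, ← Finset.sum_add_distrib]
      refine Finset.sum_congr rfl fun p hp ↦ ?_
      rw [hFTC p hp]
      have hI : ∫ t in y₀..y k, c p * g' p t * E p k = c p * (∫ t in y₀..y k, g' p t) * E p k := by
        rw [← intervalIntegral.integral_const_mul, ← intervalIntegral.integral_mul_const]
      rw [hI]
      ring
    rw [hrep]
    refine (norm_add_le _ _).trans (add_le_add le_rfl ?_)
    calc ‖∫ t in y₀..y k, ∑ p ∈ P, c p * g' p t * E p k‖
        ≤ ∫ t in y₀..y k, ‖∑ p ∈ P, c p * g' p t * E p k‖ :=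
          intervalIntegral.norm_integral_le_integral_norm hk0
      _ ≤ ∫ t in y₀..y₁, ‖∑ p ∈ P, c p * g' p t * E p k‖ :=
          intervalIntegral.integral_mono_interval le_rfl hk0 hk1
            (Filter.Eventually.of_forall fun t ↦ norm_nonneg _) (hintN k)
  -- the value family at `y₀`
  have h0 : ∑ k ∈ 𝒦, ‖∑ p ∈ P, c p * g p y₀ * E p k‖ ≤ Λ * (B₀ * C) :=
    (hΛ (fun p ↦ c p * g p y₀)).trans
      (mul_le_mul_of_nonneg_left (sqrt_sum_norm_sq_mul_le P c (fun p ↦ g p y₀) hB₀0 hB₀) hΛ0)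
  -- the derivative families under the integral
  have h1 : ∑ k ∈ 𝒦, ∫ t in y₀..y₁, ‖∑ p ∈ P, c p * g' p t * E p k‖ ≤ (y₁ - y₀) * (Λ * (B₁ * C)) := by
    rw [← intervalIntegral.integral_finsetSum (fun k _ ↦ hintN k)]
    have hmono : (∫ t in y₀..y₁, ∑ k ∈ 𝒦, ‖∑ p ∈ P, c p * g' p t * E p k‖) ≤
        ∫ _ in y₀..y₁, Λ * (B₁ * C) := by
      refine intervalIntegral.integral_mono_on hy ?_ ?_ fun t ht ↦ ?_
      · refine ContinuousOn.intervalIntegrable ?_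
        rw [hIcc]
        exact continuousOn_finsetSum _ fun k _ ↦ hcontN k
      · exact _root_.intervalIntegrable_const
      · exact (hΛ (fun p ↦ c p * g' p t)).trans
          (mul_le_mul_of_nonneg_left
            (sqrt_sum_norm_sq_mul_le P c (fun p ↦ g' p t) hB₁0 (fun p hp ↦ hB₁ p hp t ht)) hΛ0)
    refine hmono.trans ?_
    rw [intervalIntegral.integral_const, smul_eq_mul]
  calc ∑ k ∈ 𝒦, ‖∑ p ∈ P, c p * g p (y k) * E p k‖
      ≤ ∑ k ∈ 𝒦, (‖∑ p ∈ P, c p * g p y₀ * E p k‖ + ∫ t in y₀..y₁, ‖∑ p ∈ P, c p * g' p t * E p k‖) :=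
        Finset.sum_le_sum hk
    _ = ∑ k ∈ 𝒦, ‖∑ p ∈ P, c p * g p y₀ * E p k‖ +
          ∑ k ∈ 𝒦, ∫ t in y₀..y₁, ‖∑ p ∈ P, c p * g' p t * E p k‖ := Finset.sum_add_distrib
    _ ≤ Λ * (B₀ * C) + (y₁ - y₀) * (Λ * (B₁ * C)) := add_le_add h0 h1
    _ = Λ * (B₀ + (y₁ - y₀) * B₁) * C := by ring

/-! ### §2. The `k`-family with a `C¹` sample weight -/

/-- **The `k`-family large sieve with a `C¹` sample-dependent weight.** For pairs `p ∈ P` with product variable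
`ν p ∈ [1,Y]` of fibre multiplicity `≤ d`, a family `𝒦 ⊂ ℤ` hitting each residue mod `D ≥ 1` at most `m` times,
`σ = ±1`, coefficients `c p`, `C¹` weights `g p` on `[y₀,y₁]` (`‖g p y₀‖ ≤ B₀`, `‖g′ p‖ ≤ B₁`) and samples `y k ∈ [y₀,y₁]`:
`Σ_{k∈𝒦} ‖Σ_p c p·g p (y k)·e(σν_p k/D)‖ ≤ √#𝒦·√(m·((Y+1+2D)·d))·(B₀ + (y₁−y₀)B₁)·√(Σ_p ‖c p‖²)`
— the W3 half of the a8P-short bound for the box transform read at the sample heights `y k = (n₀/e)·k`.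
[cite: Montgomery1971, Lemma 1.1 — derivation] -/
theorem sum_norm_productPhase_weight_le_of_hasDerivAt {ι : Type*} (P : Finset ι) (ν : ι → ℕ) {Y : ℕ}
    (hν : ∀ p ∈ P, ν p ∈ Icc 1 Y) {d : ℕ} (hd : ∀ p ∈ P, (P.filter (fun p' ↦ ν p' = ν p)).card ≤ d)
    (𝒦 : Finset ℤ) {D : ℕ} (hD : 0 < D) {m : ℕ}
    (hm : ∀ r : ZMod D, (𝒦.filter (fun k : ℤ ↦ (k : ZMod D) = r)).card ≤ m) {σ : ℝ} (hσ : σ = 1 ∨ σ = -1)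
    (c : ι → ℂ) (g g' : ι → ℝ → ℂ) {y₀ y₁ : ℝ} (hy : y₀ ≤ y₁)
    (hg : ∀ p ∈ P, ∀ t ∈ Set.Icc y₀ y₁, HasDerivAt (g p) (g' p t) t)
    (hg' : ∀ p ∈ P, ContinuousOn (g' p) (Set.Icc y₀ y₁))
    {B₀ B₁ : ℝ} (hB₀0 : 0 ≤ B₀) (hB₁0 : 0 ≤ B₁) (hB₀ : ∀ p ∈ P, ‖g p y₀‖ ≤ B₀)
    (hB₁ : ∀ p ∈ P, ∀ t ∈ Set.Icc y₀ y₁, ‖g' p t‖ ≤ B₁)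
    (y : ℤ → ℝ) (hyk : ∀ k ∈ 𝒦, y k ∈ Set.Icc y₀ y₁) :
    ∑ k ∈ 𝒦, ‖∑ p ∈ P, c p * g p (y k) * e (σ * ((ν p : ℝ) * k / D))‖ ≤
      Real.sqrt 𝒦.card * Real.sqrt (m * (((Y : ℝ) + 1 + 2 * D) * d)) * (B₀ + (y₁ - y₀) * B₁) *
        Real.sqrt (∑ p ∈ P, ‖c p‖ ^ 2) := by
  have hΛ : ∀ b : ι → ℂ, ∑ k ∈ 𝒦, ‖∑ p ∈ P, b p * e (σ * ((ν p : ℝ) * k / D))‖ ≤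
      Real.sqrt 𝒦.card * Real.sqrt (m * (((Y : ℝ) + 1 + 2 * D) * d)) * Real.sqrt (∑ p ∈ P, ‖b p‖ ^ 2) := by
    intro b
    have h := sum_norm_productPhase_le_sqrt P ν hν hd b 𝒦 hD hm hσ
    have hsplit : Real.sqrt ((m : ℝ) * (((Y : ℝ) + 1 + 2 * D) * (d * ∑ p ∈ P, ‖b p‖ ^ 2))) =
        Real.sqrt (m * (((Y : ℝ) + 1 + 2 * D) * d)) * Real.sqrt (∑ p ∈ P, ‖b p‖ ^ 2) := by
      rw [← Real.sqrt_mul (by positivity)]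
      congr 1
      ring
    rw [hsplit, ← mul_assoc] at h
    exact h
  exact sum_norm_family_weight_le_of_hasDerivAt P 𝒦 (fun p k ↦ e (σ * ((ν p : ℝ) * k / D))) (by positivity) hΛ
    c g g' hy hg hg' hB₀0 hB₁0 hB₀ hB₁ y hyk

end Summit.Parity.GeneralizedHardyLittlewood.Theorems.BeyondDiagonalBeatsQuarter.OffDiag
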